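import Literature.Topology.FourManifolds.PlanarLefschetzBodyWinding
import Literature.Topology.PlaneTopology.JordanCurve
import Literature.Topology.PlaneTopology.JordanSweepParity
import HarnessLib

/-!
# The core of a vanishing cycle of a planar Lefschetz body as a Jordan loop of the page:
# which holes it encloses

Topic `Literature/Topology/FourManifolds`, sequel to `PlanarLefschetzBody.lean` (D-b of the
vocabulary programme of the crux `ConvexBisection.PlanarAcyclicBisectionRigidity`) and
`PlanarLefschetzBodyWinding.lean` (winding numbers of realising cycles) over the tree's
PROVED plane topology (`PlaneTopology/JordanSweepParity.lean`: Jordan loops, `inside`, `outside`,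
"inside ⇔ non-zero winding number"; `JordanCurve.lean`).  Everything here is PROVED; no named
facts.

An embedded vanishing cycle `γ` on the smooth model page `SmoothPlanarPage n` has a CORE LOOP
`γ.coreLoop : ℝ → ℂ`, `t ↦ γ(e^{2πit})` read in the topological page `PlanarPage n ⊂ ℂ`
(`SignedCycle.coreLoop`; this is the loop of `SignedCycle.pageLoop` on `[0, 1]`).  When the core
`γ.curve : 𝕊¹ → P_n` is continuous and injective (as it is for every cycle of a Lefschetz link,
whose annulus charts are smooth embeddings) the core loop is a JORDAN LOOP (`isJordanLoop_coreLoop`)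
lying in the page, so it misses the `n` open hole discs `B(c_j, ρ)` and the exterior `{‖z‖ > 1}`
of the unit disc, each of which is connected; hence (`IsJordanLoop.subset_inside_or_subset_outside`,
`mem_inside_iff_wind_ne_zero`):

* **the open disc of hole `j` lies INSIDE the core iff the core winds about `c_j`, and OUTSIDE
  iff it does not** (`ball_holeCentre_subset_inside_coreLoop`,
  `ball_holeCentre_subset_outside_coreLoop`) — with `PlanarLefschetzBodyWinding.lean`
  (`SignedCycle.Realises.wind_core_sub_holeCentre`: a cycle realising the syntactic curve
  `g(c_[a,b])` winds once about the centres of the holes `π_g([a,b])` and not about the others)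
  this says that the vanishing cycle of a letter encloses EXACTLY the holes of its syntactic hole
  set, the geometric input of Oba's cancellation argument (Oba 2016, §3.2, Fig. 2: a cycle around
  the holes `S` passes once over the 1-handles of `P_n × D²` belonging to the holes of `S`);
* **the exterior of the unit disc lies OUTSIDE the core** (`setOf_one_lt_norm_subset_outside_coreLoop`);
* §4 **a cycle REALISING the syntactic curve `c = g(c_[a,b])` with embedded core encloses the
  open disc of hole `j` if `j ∈ π_g([a, b])` and leaves it outside otherwise**
  (`SignedCycle.Realises.ball_holeCentre_subset_inside_of_mem`,
  `SignedCycle.Realises.ball_holeCentre_subset_outside_of_not_mem`).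

The statements are given first for an arbitrary Jordan loop carried by the page
(`PlanarPage.ball_holeCentre_subset_inside_of_wind_ne_zero`, …), then for core loops.

## References
* T. Oba, *Stein fillings of homology 3-spheres and mapping class groups*, Geom. Dedicata 183
  (2016), §3.2 (arXiv:1407.5257). [Oba2016]
* J. McCleary, *A First Course in Topology: Continuity and Dimension* (2006), Ch. 9 (Jordan curve
  theorem). [Mccleary2006]
* B. Farb, D. Margalit, *A Primer on Mapping Class Groups* (2012), §1.2–1.3. [FarbMargalit2012]
-/

noncomputable section

open Set Function Complex Metric Bornology
open scoped Real Manifold ContDiff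
open Literature.Topology.PlaneTopology

namespace Literature.Topology.FourManifolds

open PlanarWords (PlanarCurve Letter)

variable {n : ℕ}

/-! ### §1 Jordan loops carried by the page: hole discs and the exterior -/

namespace PlanarPage

/-- The open disc of hole `j` misses the page. [folklore] -/
theorem ball_holeCentre_disjoint_pageSet (j : Fin n) :
    Disjoint (ball (holeCentre n j : ℂ) (holeRadius n)) (pageSet n) := by
  refine disjoint_left.2 fun z hz hzp => ?_
  rw [mem_ball, dist_eq_norm] at hz
  exact not_le.2 hz (hzp.2 j)

/-- The exterior of the unit disc misses the page. [folklore] -/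
theorem setOf_one_lt_norm_disjoint_pageSet :
    Disjoint {z : ℂ | 1 < ‖z‖} (pageSet n) :=
  disjoint_left.2 fun _ hz hzp => not_le.2 hz hzp.1

/-- The hole centres are not on the page. [folklore] -/
theorem holeCentre_notMem_pageSet (j : Fin n) : (holeCentre n j : ℂ) ∉ pageSet n := fun h =>
  disjoint_left.1 (ball_holeCentre_disjoint_pageSet j) (mem_ball_self (holeRadius_pos n)) h

variable {L : ℝ → ℂ}

/-- A set missing the page misses every loop carried by the page. [folklore] -/
theorem subset_compl_range_of_disjoint_pageSet (hL : ∀ t, L t ∈ pageSet n) {A : Set ℂ}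
    (hA : Disjoint A (pageSet n)) : A ⊆ (range L)ᶜ := by
  rintro z hz ⟨t, rfl⟩
  exact disjoint_left.1 hA hz (hL t)

/-- **A Jordan loop in the page encloses the whole open disc of hole `j` as soon as it winds about
its centre** (the disc is connected and misses the loop, so it lies inside or outside; its centre is
inside iff the winding number is non-zero). [cite: Mccleary2006, Ch. 9] -/
theorem ball_holeCentre_subset_inside_of_wind_ne_zero (hJ : IsJordanLoop L)
    (hL : ∀ t, L t ∈ pageSet n) (j : Fin n) (hw : wind (fun t => L t - holeCentre n j) ≠ 0) :
    ball (holeCentre n j : ℂ) (holeRadius n) ⊆ IsJordanLoop.inside L := by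
  have hsub := subset_compl_range_of_disjoint_pageSet hL (ball_holeCentre_disjoint_pageSet j)
  have hc : (holeCentre n j : ℂ) ∈ ball (holeCentre n j : ℂ) (holeRadius n) :=
    mem_ball_self (holeRadius_pos n)
  rcases hJ.subset_inside_or_subset_outside (convex_ball _ _).isPreconnected hsub with h | h
  · exact h
  · exact absurd ((hJ.mem_outside_iff_wind_eq_zero (hsub hc)).1 (h hc)) hw

/-- **A Jordan loop in the page leaves the whole open disc of hole `j` outside as soon as it does
not wind about its centre.** [cite: Mccleary2006, Ch. 9] -/
theorem ball_holeCentre_subset_outside_of_wind_eq_zero (hJ : IsJordanLoop L)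
    (hL : ∀ t, L t ∈ pageSet n) (j : Fin n) (hw : wind (fun t => L t - holeCentre n j) = 0) :
    ball (holeCentre n j : ℂ) (holeRadius n) ⊆ IsJordanLoop.outside L := by
  have hsub := subset_compl_range_of_disjoint_pageSet hL (ball_holeCentre_disjoint_pageSet j)
  have hc : (holeCentre n j : ℂ) ∈ ball (holeCentre n j : ℂ) (holeRadius n) :=
    mem_ball_self (holeRadius_pos n)
  rcases hJ.subset_inside_or_subset_outside (convex_ball _ _).isPreconnected hsub with h | h
  · exact absurd hw ((hJ.mem_inside_iff_wind_ne_zero (hsub hc)).1 (h hc))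
  · exact h

/-- **The exterior of the unit disc lies outside every loop carried by the page** (it is
connected, unbounded and misses the loop). [cite: Mccleary2006, Ch. 9] -/
theorem setOf_one_lt_norm_subset_outside (hL : ∀ t, L t ∈ pageSet n) :
    {z : ℂ | 1 < ‖z‖} ⊆ IsJordanLoop.outside L :=
  IsJordanLoop.subset_outside_of_isPreconnected (isConnected_setOf_lt_norm zero_le_one).isPreconnected
    (subset_compl_range_of_disjoint_pageSet hL setOf_one_lt_norm_disjoint_pageSet)
    (not_isBounded_setOf_lt_norm 1)

/-- Points outside the unit disc have winding number `0` with respect to every loop carried by the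
page. [folklore] -/
theorem wind_sub_eq_zero_of_one_lt_norm (hLc : Continuous L) (hL01 : L 0 = L 1)
    (hL : ∀ t, L t ∈ pageSet n) {z : ℂ} (hz : 1 < ‖z‖) : wind (fun t => L t - z) = 0 := by
  have hsub : {z : ℂ | 1 < ‖z‖} ⊆ (L '' Icc 0 1)ᶜ := by
    rintro w hw ⟨t, -, rfl⟩
    exact not_le.2 hw (hL t).1
  exact wind_sub_eq_zero_of_not_isBounded hLc.continuousOn hL01
    (not_isBounded_connectedComponentIn_of_subset (isConnected_setOf_lt_norm zero_le_one).isPreconnected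
      hsub (not_isBounded_setOf_lt_norm 1) hz)

end PlanarPage

/-! ### §2 The core loop of a signed cycle on the smooth model page -/

/-- **`circlePt` is injective on a fundamental domain**: `e^{2πis} = e^{2πit}` with
`s, t ∈ [0, 1)` forces `s = t`. [folklore] -/
theorem circlePt_injOn_Ico : InjOn circlePt (Ico (0 : ℝ) 1) := by
  intro s hs t ht hst
  have h := congrArg toCircle hst
  rw [toCircle_circlePt, toCircle_circlePt] at h
  have hinj := Circle.exp_injOn_Ico (a := 0) (b := 2 * π) (by linarith)
  have hs' : 2 * π * s ∈ Ico (0 : ℝ) (2 * π) :=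
    ⟨by nlinarith [Real.pi_pos, hs.1], by nlinarith [Real.pi_pos, hs.2]⟩
  have ht' : 2 * π * t ∈ Ico (0 : ℝ) (2 * π) :=
    ⟨by nlinarith [Real.pi_pos, ht.1], by nlinarith [Real.pi_pos, ht.2]⟩
  have := hinj hs' ht' h
  nlinarith [Real.pi_pos]

namespace SignedCycle

/-- **The core loop of a signed cycle on the smooth model page, read in `ℂ`**:
`t ↦ γ(e^{2πit}) ∈ P_n ⊂ ℂ` (through the homeomorphism `SmoothPlanarPage.toPlanarPage`).  On
`[0, 1]` this is the loop `SignedCycle.pageLoop` of `PlanarLefschetzBody.lean`. [folklore] -/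
def coreLoop (γ : SignedCycle (SmoothPlanarPage n)) (t : ℝ) : ℂ :=
  ((SmoothPlanarPage.toPlanarPage n (γ.curve (circlePt t)) : PlanarPage n) : ℂ)

variable (γ : SignedCycle (SmoothPlanarPage n))

/-- The core loop runs in the page. [folklore] -/
theorem coreLoop_mem_pageSet (t : ℝ) : γ.coreLoop t ∈ PlanarPage.pageSet n :=
  (SmoothPlanarPage.toPlanarPage n (γ.curve (circlePt t))).2

/-- The core loop is `1`-periodic. [folklore] -/
theorem periodic_coreLoop : Periodic γ.coreLoop 1 := fun t => by
  simp only [coreLoop, circlePt_add_one]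

/-- The core loop closes up on `[0, 1]`. [folklore] -/
theorem coreLoop_zero_eq_one : γ.coreLoop 0 = γ.coreLoop 1 := by
  have := γ.periodic_coreLoop 0
  rw [zero_add] at this
  exact this.symm

variable {γ}

/-- The core loop of a cycle with continuous core is continuous. [folklore] -/
theorem continuous_coreLoop (hγ : Continuous γ.curve) : Continuous γ.coreLoop :=
  continuous_subtype_val.comp ((SmoothPlanarPage.toPlanarPage n).continuous.comp
    (hγ.comp continuous_circlePt))

/-- The page loop of `PlanarLefschetzBody.lean` is the core loop on `[0, 1]`. [folklore] -/
theorem coe_pageLoop_apply (hγ : Continuous γ.curve) (t : unitInterval) :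
    ((γ.pageLoop hγ t : PlanarPage n) : ℂ) = γ.coreLoop t := rfl

/-- The core loop of a cycle with injective core is injective on `[0, 1)`. [folklore] -/
theorem injOn_coreLoop (hinj : Injective γ.curve) : InjOn γ.coreLoop (Ico 0 1) := by
  intro s hs t ht hst
  have h1 : SmoothPlanarPage.toPlanarPage n (γ.curve (circlePt s)) =
      SmoothPlanarPage.toPlanarPage n (γ.curve (circlePt t)) := Subtype.ext hst
  exact circlePt_injOn_Ico hs ht (hinj ((SmoothPlanarPage.toPlanarPage n).injective h1))

/-- **The core loop of an embedded cycle is a Jordan loop** (continuous and injective core).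
[folklore] -/
theorem isJordanLoop_coreLoop (hγ : Continuous γ.curve) (hinj : Injective γ.curve) :
    IsJordanLoop γ.coreLoop :=
  ⟨continuous_coreLoop hγ, γ.periodic_coreLoop, injOn_coreLoop hinj⟩

/-- **The open disc of hole `j` lies INSIDE the core of an embedded cycle iff the core winds about
`c_j`** (the "if" direction; the winding number of a Jordan loop about an inside point is `±1`).
[cite: Mccleary2006, Ch. 9] -/
theorem ball_holeCentre_subset_inside_coreLoop (hγ : Continuous γ.curve) (hinj : Injective γ.curve)
    (j : Fin n) (hw : wind (fun t => γ.coreLoop t - PlanarPage.holeCentre n j) ≠ 0) :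
    ball (PlanarPage.holeCentre n j : ℂ) (PlanarPage.holeRadius n) ⊆
      IsJordanLoop.inside γ.coreLoop :=
  PlanarPage.ball_holeCentre_subset_inside_of_wind_ne_zero (isJordanLoop_coreLoop hγ hinj)
    γ.coreLoop_mem_pageSet j hw

/-- **The open disc of hole `j` lies OUTSIDE the core of an embedded cycle iff the core does not
wind about `c_j`** (the "if" direction). [cite: Mccleary2006, Ch. 9] -/
theorem ball_holeCentre_subset_outside_coreLoop (hγ : Continuous γ.curve)
    (hinj : Injective γ.curve) (j : Fin n)
    (hw : wind (fun t => γ.coreLoop t - PlanarPage.holeCentre n j) = 0) :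
    ball (PlanarPage.holeCentre n j : ℂ) (PlanarPage.holeRadius n) ⊆
      IsJordanLoop.outside γ.coreLoop :=
  PlanarPage.ball_holeCentre_subset_outside_of_wind_eq_zero (isJordanLoop_coreLoop hγ hinj)
    γ.coreLoop_mem_pageSet j hw

/-- The converse bookkeeping: if the hole disc lies inside, the core winds about the centre.
[folklore] -/
theorem wind_coreLoop_sub_holeCentre_ne_zero_of_subset_inside (hγ : Continuous γ.curve)
    (hinj : Injective γ.curve) (j : Fin n)
    (h : ball (PlanarPage.holeCentre n j : ℂ) (PlanarPage.holeRadius n) ⊆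
      IsJordanLoop.inside γ.coreLoop) :
    wind (fun t => γ.coreLoop t - PlanarPage.holeCentre n j) ≠ 0 :=
  ((isJordanLoop_coreLoop hγ hinj).mem_inside_iff_wind_ne_zero
    (PlanarPage.subset_compl_range_of_disjoint_pageSet γ.coreLoop_mem_pageSet
      (PlanarPage.ball_holeCentre_disjoint_pageSet j) (mem_ball_self (PlanarPage.holeRadius_pos n)))).1
    (h (mem_ball_self (PlanarPage.holeRadius_pos n)))

/-- If the hole disc lies outside, the core does not wind about the centre. [folklore] -/
theorem wind_coreLoop_sub_holeCentre_eq_zero_of_subset_outside (hγ : Continuous γ.curve)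
    (hinj : Injective γ.curve) (j : Fin n)
    (h : ball (PlanarPage.holeCentre n j : ℂ) (PlanarPage.holeRadius n) ⊆
      IsJordanLoop.outside γ.coreLoop) :
    wind (fun t => γ.coreLoop t - PlanarPage.holeCentre n j) = 0 :=
  ((isJordanLoop_coreLoop hγ hinj).mem_outside_iff_wind_eq_zero
    (PlanarPage.subset_compl_range_of_disjoint_pageSet γ.coreLoop_mem_pageSet
      (PlanarPage.ball_holeCentre_disjoint_pageSet j) (mem_ball_self (PlanarPage.holeRadius_pos n)))).1
    (h (mem_ball_self (PlanarPage.holeRadius_pos n)))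

/-- **The exterior of the unit disc lies outside the core** of any cycle on the page.
[cite: Mccleary2006, Ch. 9] -/
theorem setOf_one_lt_norm_subset_outside_coreLoop (γ : SignedCycle (SmoothPlanarPage n)) :
    {z : ℂ | 1 < ‖z‖} ⊆ IsJordanLoop.outside γ.coreLoop :=
  PlanarPage.setOf_one_lt_norm_subset_outside γ.coreLoop_mem_pageSet

/-- The core of a cycle with continuous core does not wind about points outside the unit disc.
[folklore] -/
theorem wind_coreLoop_sub_eq_zero_of_one_lt_norm (hγ : Continuous γ.curve) {z : ℂ}
    (hz : 1 < ‖z‖) : wind (fun t => γ.coreLoop t - z) = 0 :=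
  PlanarPage.wind_sub_eq_zero_of_one_lt_norm (continuous_coreLoop hγ) γ.coreLoop_zero_eq_one
    γ.coreLoop_mem_pageSet hz

/-- **The inside of the core of an embedded cycle lies in the closed unit disc** (the exterior is
outside, and inside and outside are disjoint). [folklore] -/
theorem inside_coreLoop_subset_closedBall (γ : SignedCycle (SmoothPlanarPage n)) :
    IsJordanLoop.inside γ.coreLoop ⊆ closedBall (0 : ℂ) 1 := by
  intro z hz
  rw [mem_closedBall, dist_zero_right]
  by_contra h
  exact disjoint_left.1 IsJordanLoop.disjoint_inside_outside hz
    (setOf_one_lt_norm_subset_outside_coreLoop γ (not_le.1 h))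

end SignedCycle

/-! ### §3 Cycles of a Lefschetz link over the model page have embedded, continuous cores -/

namespace IsLefschetzLinkOver

universe u

variable {w : List (SignedCycle (SmoothPlanarPage n))} {B : Type u} [TopologicalSpace B]
  [ChartedSpace (EuclideanHalfSpace 4) B] {b : BoundaryData (𝓡∂ 4) B (𝓡 3)}
  {ob : Literature.Geometry.Symplectic.OpenBook b.carrier} {J : SmoothPlanarPage n × ℝ → b.carrier}
  {δ : ℝ} {h : Fin w.length → HandleAttachingMap 3 2 B}

/-- The core of every cycle of a Lefschetz link is continuous (its annulus chart is a smooth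
embedding). [folklore] -/
theorem continuous_curve (hl : IsLefschetzLinkOver (SmoothPlanarPage.orientation n) w b ob J δ h)
    (i : Fin w.length) : Continuous (w.get i).curve :=
  (hl.isSmoothEmbedding i).isEmbedding.continuous.comp (Continuous.prodMk_left (0 : ℝ))

/-- The core of every cycle of a Lefschetz link is injective (its annulus chart is an embedding).
[folklore] -/
theorem injective_curve (hl : IsLefschetzLinkOver (SmoothPlanarPage.orientation n) w b ob J δ h)
    (i : Fin w.length) : Injective (w.get i).curve := fun _ _ hxy =>
  congrArg Prod.fst ((hl.isSmoothEmbedding i).isEmbedding.injective hxy)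

/-- **The core loop of every cycle of a Lefschetz link over the model page is a Jordan loop.**
[folklore] -/
theorem isJordanLoop_coreLoop
    (hl : IsLefschetzLinkOver (SmoothPlanarPage.orientation n) w b ob J δ h) (i : Fin w.length) :
    IsJordanLoop (w.get i).coreLoop :=
  SignedCycle.isJordanLoop_coreLoop (hl.continuous_curve i) (hl.injective_curve i)

end IsLefschetzLinkOver

/-! ### §4 A realising cycle encloses exactly the holes of the hole set of its syntactic curve -/

namespace SignedCycle

variable {c : PlanarCurve} {γ : SignedCycle (SmoothPlanarPage n)}

/-- The winding numbers of the core loop of a cycle realising `c` are the exponent sums of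
`cls n c` (`PlanarLefschetzBodyWinding.lean`, restated for `coreLoop`). [folklore] -/
theorem Realises.wind_coreLoop_sub_holeCentre (h : γ.Realises n c) (j : Fin n) :
    wind (fun t => γ.coreLoop t - PlanarPage.holeCentre n j) =
      Multiplicative.toAdd (PlanarWords.holeExp j (c.cls n)) :=
  h.wind_core_sub_holeCentre j

/-- **A realising cycle with embedded core encloses the disc of every hole of non-zero exponent.**
[cite: Oba2016, §3.2] -/
theorem Realises.ball_holeCentre_subset_inside (h : γ.Realises n c) (hinj : Injective γ.curve)
    (j : Fin n) (hj : Multiplicative.toAdd (PlanarWords.holeExp j (c.cls n)) ≠ 0) :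
    ball (PlanarPage.holeCentre n j : ℂ) (PlanarPage.holeRadius n) ⊆
      IsJordanLoop.inside γ.coreLoop := by
  have hγ : Continuous γ.curve := h.fst
  exact ball_holeCentre_subset_inside_coreLoop hγ hinj j (by rwa [h.wind_coreLoop_sub_holeCentre j])

/-- **A realising cycle with embedded core leaves outside the disc of every hole of exponent
zero.** [cite: Oba2016, §3.2] -/
theorem Realises.ball_holeCentre_subset_outside (h : γ.Realises n c) (hinj : Injective γ.curve)
    (j : Fin n) (hj : Multiplicative.toAdd (PlanarWords.holeExp j (c.cls n)) = 0) :
    ball (PlanarPage.holeCentre n j : ℂ) (PlanarPage.holeRadius n) ⊆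
      IsJordanLoop.outside γ.coreLoop := by
  have hγ : Continuous γ.curve := h.fst
  exact ball_holeCentre_subset_outside_coreLoop hγ hinj j (by rw [h.wind_coreLoop_sub_holeCentre j, hj])

/-- **Hole-set form, inside**: for `c = g(c_[a,b])` and `j ∈ π_g([a, b])` the disc of hole `j` is
inside the core of any embedded cycle realising `c`. [cite: Oba2016, §3.2] -/
theorem Realises.ball_holeCentre_subset_inside_of_mem (h : γ.Realises n c)
    (hinj : Injective γ.curve) (j : Fin n)
    (hj : c.a ≤ ((PlanarWords.evalWord n c.g).perm.symm j).val ∧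
      ((PlanarWords.evalWord n c.g).perm.symm j).val ≤ c.b) :
    ball (PlanarPage.holeCentre n j : ℂ) (PlanarPage.holeRadius n) ⊆
      IsJordanLoop.inside γ.coreLoop :=
  h.ball_holeCentre_subset_inside hinj j (by rw [PlanarWords.toAdd_holeExp_cls, if_pos hj]; exact one_ne_zero)

/-- **Hole-set form, outside**: for `c = g(c_[a,b])` and `j ∉ π_g([a, b])` the disc of hole `j`
is outside the core of any embedded cycle realising `c`. [cite: Oba2016, §3.2] -/
theorem Realises.ball_holeCentre_subset_outside_of_not_mem (h : γ.Realises n c)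
    (hinj : Injective γ.curve) (j : Fin n)
    (hj : ¬ (c.a ≤ ((PlanarWords.evalWord n c.g).perm.symm j).val ∧
      ((PlanarWords.evalWord n c.g).perm.symm j).val ≤ c.b)) :
    ball (PlanarPage.holeCentre n j : ℂ) (PlanarPage.holeRadius n) ⊆
      IsJordanLoop.outside γ.coreLoop :=
  h.ball_holeCentre_subset_outside hinj j (by rw [PlanarWords.toAdd_holeExp_cls, if_neg hj])

/-- **Dichotomy**: every hole disc is inside or outside the core of an embedded realising cycle,
according to the hole set. [folklore] -/
theorem Realises.ball_holeCentre_subset_inside_or_outside (h : γ.Realises n c)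
    (hinj : Injective γ.curve) (j : Fin n) :
    ball (PlanarPage.holeCentre n j : ℂ) (PlanarPage.holeRadius n) ⊆ IsJordanLoop.inside γ.coreLoop ∨
      ball (PlanarPage.holeCentre n j : ℂ) (PlanarPage.holeRadius n) ⊆
        IsJordanLoop.outside γ.coreLoop := by
  by_cases hj : Multiplicative.toAdd (PlanarWords.holeExp j (c.cls n)) = 0
  · exact Or.inr (h.ball_holeCentre_subset_outside hinj j hj)
  · exact Or.inl (h.ball_holeCentre_subset_inside hinj j hj)

/-- **An in-range curve's realising cycle encloses at least one hole** (the hole `π_g(a)`).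
[folklore] -/
theorem Realises.ball_holeCentre_perm_subset_inside (h : γ.Realises n c) (hinj : Injective γ.curve)
    (hab : c.a ≤ c.b) (hb : c.b < n) :
    ball (PlanarPage.holeCentre n ((PlanarWords.evalWord n c.g).perm ⟨c.a, hab.trans_lt hb⟩) : ℂ)
        (PlanarPage.holeRadius n) ⊆ IsJordanLoop.inside γ.coreLoop :=
  h.ball_holeCentre_subset_inside hinj _
    (by rw [PlanarWords.toAdd_holeExp_cls_perm c hab hb]; exact one_ne_zero)

end SignedCycle

end Literature.Topology.FourManifolds

end
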